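/-
Copyright (c) 2026. All rights reserved.
Released under Apache 2.0 license as described in the file LICENSE.
Authors: abc-iut cell, fact-proving seat abc-iut-f-074 (block F, tranche 74; FACT-LIST rows F-0326,
F-0330, F-0331, F-0333 of abc-iut-L4-t9's `BiAnabelianTelecore.lean`).
-/
import Literature.AnabelianGeometry.AbsoluteAnabelian.AbsTopIII.BiAnabelianTelecoreIncompatibilityProofs
import Mathlib.CategoryTheory.PUnit
import HarnessLib

/-!
# [AbsTopIII] Corollary 3.7 (iv), second incompatibility: SCHEMA CENSUS of the typed statements
# `TelecoreIncompatibleStmt`, `Cor_3_7_iv` and of the pinning predicates `TelePinned`, `StarLogPinned`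

S. Mochizuki, *Topics in absolute anabelian geometry III* [MochizukiAbsTopIII2015] (kurims manuscript
`paper:url-5493eb38cbb7`; journal pagination not held), Cor 3.7 (iv) p. 88, second sentence: "the
telecore structure `𝔗_δ` of (ii), the family of homotopies `ℋ_δ` of (ii), and the observable `𝔖†_log`
of (iii) are not simultaneously compatible"; proof p. 88 "entirely similar to" Cor 3.6 (iv) pp. 81–82,
ending in Lemma 3.4 p. 74.

PROOF-ONLY companion of `BiAnabelianTelecore.lean` (abc-iut-L4-t9); no notion is declared.  The typed
statements there are PER-SETTING `Prop`s over an ABSTRACT `𝔖 : BiAnabelianSetting X E N` (print: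
`𝒳 = 𝒞^{MLF-sB}_{T𝔽}`, `𝔈 = 𝒯𝔾_{sB}`, `𝒩 = 𝒞^{MLF-sB}_{T𝕊}`); this file records, as kernel facts, where
their UNIVERSAL CLOSURES stand (FACT-LIST class R5: a schema row is consumed at named instances only):

* `exists_thin_allPinned` — at the THIN setting (`𝒳 = 𝔈 = 𝒩` the one-object discrete category,
  every functor the identity, `ι_log = ι_×` forced, `θ^bi` tautological) the all-pairs family of
  homotopies on `𝒟*` contains the pinned `ℋ_δ`-generators, the telecore homotopy AND the `𝔖†_log`
  homotopies at once, and the Lemma-3.4 obstruction `LogKernelObstruction` fails;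
* hence `not_forall_telecoreIncompatibleStmt`, `not_forall_cor_3_7_iv`: the universal closures of
  `TelecoreIncompatibleStmt` (F-0333) and `Cor_3_7_iv` (F-0326) over all settings and lift data are
  FALSE as typed — consistent with print, which asserts them for the MLF data of Def 3.1 only, where
  Lemma 3.4 holds; the INSTANCE forms are in the tree: every setting WITH the obstruction
  (`cor_3_7_iv_of_obstruction`, abc-iut-L4-t9), the model of MLF-Galois pairs on `ℚ̄_p`
  (`TFModel.model_cor_3_7_iv`, `TFModel.model_slim_cor_3_7`, `TFModel.model_of_cor_3_7`), and a toy
  carrying the obstruction (`cor_3_7_hypotheses_satisfiable`);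
* `TelePinned` (F-0331) and `StarLogPinned` (F-0330) are PREDICATES on a family `K` (the components of
  the negated `∃ K` above), not assertions: at EVERY setting the empty family refutes them
  (`exists_not_telePinned`, `exists_not_starLogPinned`, likewise `exists_not_deltaPinned`), so their
  universal closures are false (`not_forall_telePinned`, `not_forall_starLogPinned`), while at every
  setting the family of strict commutations satisfies `TelePinned` (`exists_telePinned`: the telecore
  homotopy `[δ_⋎] ⇝ [δ_⋎]∘[π_⋎]∘[log_𝒳]∘[δ_{⋎+1}]` is an equality of functors, `pathFunctor_telePath`) and
  at the thin setting all three pinnings are jointly satisfiable (`exists_thin_allPinned`).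

Generic tools stated for any diagram of categories (Def 3.5 (ii)): `exists_homotopyFamily_empty`,
`exists_homotopyFamily_strict` (existence forms of the empty family and of the family of strict
commutations `eqToHom`; cf. abc-iut-w4-d095's `DiagramOfCategories.strictFamily`).

HONEST FRAMING: calibration of TYPED statements; the thin setting is no model of any arithmetic object
and contradicts nothing in print.  Refereed pre-IUT anabelian geometry; nothing here bears on
[IUTchIII] Cor. 3.12; no side taken.
-/

set_option autoImplicit false

universe v' u' w' u

open CategoryTheory Quiver

namespace Literature.AnabelianGeometry.AbsoluteAnabelian

/-! ## Generic: the empty family and the family of strict commutations (Def 3.5 (ii)) -/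

namespace DiagramOfCategories

variable {V : Type w'} [Quiver.{v'} V] (D : DiagramOfCategories.{v', u', w'} V)

/-- On any diagram of categories the EMPTY boundary set carries a family of homotopies (every axiom
of Def 3.5 (ii) is conditional on membership in `E_ℋ`). [cite: MochizukiAbsTopIII2015, Definition 3.5 (ii) p.75] -/
theorem exists_homotopyFamily_empty :
    ∃ K : D.HomotopyFamily, ∀ ⦃a b : V⦄ (p q : Path a b), ¬ K.E p q :=
  ⟨{ E := fun _ _ _ _ => False
     isSaturated :=
       { refl_left := fun _ _ _ _ h => h.elim
         refl_right := fun _ _ _ _ h => h.elim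
         trans := fun _ _ _ _ _ h _ => h.elim
         precomp := fun _ _ _ _ _ h _ => h.elim
         postcomp := fun _ _ _ _ _ h _ => h.elim }
     η := fun _ _ _ _ h => h.elim
     η_refl := fun _ _ _ h => h.elim
     η_trans := fun _ _ _ _ _ h _ => h.elim
     η_whisker := fun _ _ _ _ _ _ h _ _ => h.elim }, fun _ _ _ _ h => h⟩

/-- Whiskering an `eqToHom` of functors on both sides is an `eqToHom`. [folklore] -/
private theorem whiskerLeft_whiskerRight_eqToHom' {A B B' B'' : Type u'} [Category.{v'} A]
    [Category.{v'} B] [Category.{v'} B'] [Category.{v'} B''] (R₁ : A ⥤ B) {F G : B ⥤ B'} (h : F = G)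
    (R₂ : B' ⥤ B'') :
    Functor.whiskerLeft R₁ (Functor.whiskerRight (eqToHom h) R₂) =
      eqToHom (show R₁ ⋙ F ⋙ R₂ = R₁ ⋙ G ⋙ R₂ by rw [h]) := by
  subst h
  rw [eqToHom_refl, Functor.whiskerRight_id', Functor.whiskerLeft_id', eqToHom_refl]

/-- On any diagram of categories the co-verticial pairs of paths with EQUAL path functors form a
saturated set carrying the family of strict commutations (homotopies `eqToHom`; identity on the
diagonal, composition, whiskering). [cite: MochizukiAbsTopIII2015, Definition 3.5 (ii) p.75] -/
theorem exists_homotopyFamily_strict :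
    ∃ K : D.HomotopyFamily,
      (∀ ⦃a b : V⦄ (p q : Path a b), K.E p q ↔ D.pathFunctor p = D.pathFunctor q) ∧
      ∀ ⦃a b : V⦄ ⦃p q : Path a b⦄ (h : K.E p q) (e : D.pathFunctor p = D.pathFunctor q),
        K.η h = eqToHom e := by
  refine ⟨{ E := fun _ _ p q => D.pathFunctor p = D.pathFunctor q
            isSaturated :=
              { refl_left := fun _ _ _ _ _ => rfl
                refl_right := fun _ _ _ _ _ => rfl
                trans := fun _ _ _ _ _ h₁ h₂ => h₁.trans h₂
                precomp := fun _ _ _ _ _ h r => by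
                  show D.pathFunctor (r.comp _) = D.pathFunctor (r.comp _)
                  rw [pathFunctor_comp, pathFunctor_comp, h]
                postcomp := fun _ _ _ _ _ h r => by
                  show D.pathFunctor (Path.comp _ r) = D.pathFunctor (Path.comp _ r)
                  rw [pathFunctor_comp, pathFunctor_comp, h] }
            η := fun _ _ _ _ h => eqToHom h
            η_refl := fun _ _ _ _ => eqToHom_refl _ _
            η_trans := fun _ _ _ _ _ _ _ => (eqToHom_trans _ _).symm
            η_whisker := fun _ _ _ _ _ _ h r₁ r₂ => ?_ }, fun _ _ _ _ => Iff.rfl, fun _ _ _ _ _ _ => rfl⟩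
  show eqToHom _ = eqToHom _ ≫ Functor.whiskerLeft _ (Functor.whiskerRight (eqToHom _) _) ≫ eqToHom _
  rw [whiskerLeft_whiskerRight_eqToHom']
  simp only [eqToHom_trans]

end DiagramOfCategories

namespace AbsTopIII.BiAnabelianSetting

open DiagramOfCategories

variable {X E N : Type u} [Category.{u} X] [Category.{u} E] [Category.{u} N]
  (𝔖 : BiAnabelianSetting X E N)

/-! ## Every setting: the pinning predicates are refuted by the empty family -/

/-- `TelePinned` is a PREDICATE on families, not a fact: at every setting the empty family on `𝒟*`
does not contain the telecore homotopy. [cite: MochizukiAbsTopIII2015, Cor 3.7 (iv) p.88] -/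
theorem exists_not_telePinned : ∃ K : 𝔖.starDiagram.HomotopyFamily, ¬ 𝔖.TelePinned K := by
  obtain ⟨K, hK⟩ := 𝔖.starDiagram.exists_homotopyFamily_empty
  refine ⟨K, fun h => ?_⟩
  obtain ⟨h0, -⟩ := h 0
  exact hK _ _ h0

/-- `StarLogPinned` is a PREDICATE on families, not a fact: at every setting the empty family on `𝒟*`
does not contain `ι_×`. [cite: MochizukiAbsTopIII2015, Cor 3.7 (iv) p.88] -/
theorem exists_not_starLogPinned : ∃ K : 𝔖.starDiagram.HomotopyFamily, ¬ 𝔖.StarLogPinned K := by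
  obtain ⟨K, hK⟩ := 𝔖.starDiagram.exists_homotopyFamily_empty
  refine ⟨K, fun h => ?_⟩
  obtain ⟨h0, -⟩ := h.1
  exact hK _ _ h0

/-- Likewise `DeltaPinned θ` (the pinned generators of `ℋ_δ`) fails for the empty family, for every
lift datum `θ`. [cite: MochizukiAbsTopIII2015, Cor 3.7 (ii) p.88] -/
theorem exists_not_deltaPinned (θ : FiberSquare.BiAnabelianLift 𝔖.gal) :
    ∃ K : 𝔖.starDiagram.HomotopyFamily, ¬ 𝔖.DeltaPinned θ K := by
  obtain ⟨K, hK⟩ := 𝔖.starDiagram.exists_homotopyFamily_empty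
  refine ⟨K, fun h => ?_⟩
  obtain ⟨h0, -⟩ := h.1 0
  exact hK _ _ h0

/-! ## Every setting: the telecore homotopy is a strict commutation -/

/-- The telecore path `[δ_⋎]∘[π_⋎]∘[log_𝒳]∘[δ_{⋎+1}]` and `[δ_⋎]` have EQUAL path functors on `𝒟*`
(`log_𝒳 ⋙ π = π` and `δ_𝒳 ⋙ π = 𝟭` on the nose). [cite: MochizukiAbsTopIII2015, Cor 3.7 (iv) p.88] -/
theorem pathFunctor_telePath (n : ℤ) :
    𝔖.starDiagram.pathFunctor (telePath.{u} n) = 𝔖.starDiagram.pathFunctor (deltaPath.{u} n) := by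
  simp only [telePath, deltaPath, pathFunctor_cons, pathFunctor_nil]
  rfl

/-- `TelePinned` is SATISFIABLE at every setting: the family of strict commutations on `𝒟*` contains
the telecore homotopy (an identity between equal functors). [cite: MochizukiAbsTopIII2015, Cor 3.7 (iv) p.88] -/
theorem exists_telePinned :
    ∃ K : 𝔖.starDiagram.HomotopyFamily,
      (∀ ⦃a b : Cor37Vertex⦄ (p q : Path a b),
        K.E p q ↔ 𝔖.starDiagram.pathFunctor p = 𝔖.starDiagram.pathFunctor q) ∧ 𝔖.TelePinned K := by
  obtain ⟨K, hE, hη⟩ := 𝔖.starDiagram.exists_homotopyFamily_strict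
  refine ⟨K, hE, fun n => ?_⟩
  refine ⟨(hE _ _).2 (𝔖.pathFunctor_telePath n).symm, fun x e => ?_⟩
  rw [hη _ (𝔖.pathFunctor_telePath n).symm, eqToHom_app]

end AbsTopIII.BiAnabelianSetting

/-! ## The thin setting: all three pinnings coexist, so the universal closures are false -/

namespace AbsTopIII.BiAnabelianSetting

open DiagramOfCategories Limits

/-- **The thin setting.**  `𝒳 = 𝔈 = 𝒩` the discrete one-object category, all functors identities,
`ι_log = ι_×` (forced), `θ^bi` the tautological lift datum: the ALL-PAIRS family of homotopies on `𝒟*`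
(every vertex category is thin and connected, so there is exactly one natural transformation between
any two co-verticial path functors) contains the pinned generators of `ℋ_δ` (`DeltaPinned`), the
telecore homotopy (`TelePinned`) and the `𝔖†_log` homotopies (`StarLogPinned`) SIMULTANEOUSLY, and the
Lemma-3.4 obstruction fails there.  A calibration device for the typed statements, no model of print.
[cite: MochizukiAbsTopIII2015, Cor 3.7 (iv) p.88] -/
theorem exists_thin_allPinned :
    ∃ (𝔖 : BiAnabelianSetting (Discrete PUnit.{u+1}) (Discrete PUnit.{u+1}) (Discrete PUnit.{u+1}))
      (θ : FiberSquare.BiAnabelianLift 𝔖.gal) (K : 𝔖.starDiagram.HomotopyFamily),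
      𝔖.DeltaPinned θ K ∧ 𝔖.TelePinned K ∧ 𝔖.StarLogPinned K ∧ ¬ 𝔖.LogKernelObstruction := by
  let 𝔖 : BiAnabelianSetting (Discrete PUnit.{u+1}) (Discrete PUnit.{u+1}) (Discrete PUnit.{u+1}) :=
    { gal := 𝟭 _, log := 𝟭 _, logIsoId := Iso.refl _,
      lamTimes := 𝟭 _, lamTimesPf := 𝟭 _, iotaLog := (Functor.leftUnitor (𝟭 _)).hom, iotaTimes := 𝟙 _,
      spaceGal := 𝟭 _, lamTimesGal := Functor.punitExt _ _, lamTimesPfGal := Functor.punitExt _ _ }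
  -- the tautological bi-anabelian lift datum over `gal = 𝟭` of the discrete one-object category
  let θ : FiberSquare.BiAnabelianLift 𝔖.gal :=
    { θbi := NatIso.ofComponents (fun _ => eqToIso (Subsingleton.elim _ _))
        (fun _ => Subsingleton.elim _ _),
      map_θbi := fun _ => Subsingleton.elim _ _ }
  -- every vertex category of `𝒟*` is thin ...
  have thin : ∀ (b : Cor37Vertex) (x y : 𝔖.starDiagram.obj b) (f g : x ⟶ y), f = g := by
    intro b
    cases b with
    | first n =>
      change ∀ (x y : CategoricalPullback (𝟭 (Discrete PUnit.{u+1})) (𝟭 (Discrete PUnit.{u+1})))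
        (f g : x ⟶ y), f = g
      intro x y f g
      exact CategoricalPullback.hom_ext (Subsingleton.elim _ _) (Subsingleton.elim _ _)
    | box =>
      change ∀ (x y : Discrete PUnit.{u+1}) (f g : x ⟶ y), f = g
      exact fun _ _ _ _ => Subsingleton.elim _ _
    | space =>
      change ∀ (x y : Discrete PUnit.{u+1}) (f g : x ⟶ y), f = g
      exact fun _ _ _ _ => Subsingleton.elim _ _
    | galois =>
      change ∀ (x y : Discrete PUnit.{u+1}) (f g : x ⟶ y), f = g
      exact fun _ _ _ _ => Subsingleton.elim _ _
    | ref =>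
      change ∀ (x y : Discrete PUnit.{u+1}) (f g : x ⟶ y), f = g
      exact fun _ _ _ _ => Subsingleton.elim _ _
  -- ... and connected
  have conn : ∀ (b : Cor37Vertex) (x y : 𝔖.starDiagram.obj b), Nonempty (x ⟶ y) := by
    intro b
    cases b with
    | first n =>
      change ∀ (x y : CategoricalPullback (𝟭 (Discrete PUnit.{u+1})) (𝟭 (Discrete PUnit.{u+1}))),
        Nonempty (x ⟶ y)
      intro x y
      exact ⟨⟨eqToHom (Subsingleton.elim _ _), eqToHom (Subsingleton.elim _ _), Subsingleton.elim _ _⟩⟩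
    | box =>
      change ∀ (x y : Discrete PUnit.{u+1}), Nonempty (x ⟶ y)
      exact fun _ _ => ⟨eqToHom (Subsingleton.elim _ _)⟩
    | space =>
      change ∀ (x y : Discrete PUnit.{u+1}), Nonempty (x ⟶ y)
      exact fun _ _ => ⟨eqToHom (Subsingleton.elim _ _)⟩
    | galois =>
      change ∀ (x y : Discrete PUnit.{u+1}), Nonempty (x ⟶ y)
      exact fun _ _ => ⟨eqToHom (Subsingleton.elim _ _)⟩
    | ref =>
      change ∀ (x y : Discrete PUnit.{u+1}), Nonempty (x ⟶ y)
      exact fun _ _ => ⟨eqToHom (Subsingleton.elim _ _)⟩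
  -- the all-pairs family: the unique natural transformation between any two co-verticial path functors
  let K : 𝔖.starDiagram.HomotopyFamily :=
    { E := fun _ _ _ _ => True
      isSaturated :=
        { refl_left := fun _ _ _ _ _ => trivial
          refl_right := fun _ _ _ _ _ => trivial
          trans := fun _ _ _ _ _ _ _ => trivial
          precomp := fun _ _ _ _ _ _ _ => trivial
          postcomp := fun _ _ _ _ _ _ _ => trivial }
      η := fun _ b _ _ _ =>
        { app := fun x => (conn b _ _).some
          naturality := fun _ _ _ => thin b _ _ _ _ }
      η_refl := fun _ b _ _ => NatTrans.ext (funext fun _ => thin b _ _ _ _)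
      η_trans := fun _ b _ _ _ _ _ => NatTrans.ext (funext fun _ => thin b _ _ _ _)
      η_whisker := fun _ _ _ d _ _ _ _ _ => NatTrans.ext (funext fun _ => thin d _ _ _ _) }
  refine ⟨𝔖, θ, K, ⟨fun n => ⟨trivial, fun x e => thin _ _ _ _ _⟩,
    fun n => ⟨trivial, fun o e₁ e₂ => thin _ _ _ _ _⟩⟩, fun n => ⟨trivial, fun x e => thin _ _ _ _ _⟩,
    ⟨⟨trivial, fun x e₁ e₂ => thin _ _ _ _ _⟩, fun n => ⟨trivial, fun o e₁ e₂ => thin _ _ _ _ _⟩⟩, ?_⟩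
  -- the Lemma-3.4 obstruction fails: `ι_log = ι_×` in a thin `𝒩`
  rintro ⟨x₀, hx₀⟩
  exact hx₀ (𝟙 x₀) (inferInstanceAs (IsIso (𝟙 x₀))) (Subsingleton.elim _ _)

/-- A thin-setting instance at which `TelecoreIncompatibleStmt` and `Cor_3_7_iv` FAIL (and, as the
reduction `telecoreIncompatibleStmt_of_obstruction` predicts, the Lemma-3.4 obstruction fails).
[cite: MochizukiAbsTopIII2015, Cor 3.7 (iv) p.88] -/
theorem exists_not_telecoreIncompatibleStmt :
    ∃ (𝔖 : BiAnabelianSetting (Discrete PUnit.{u+1}) (Discrete PUnit.{u+1}) (Discrete PUnit.{u+1}))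
      (θ : FiberSquare.BiAnabelianLift 𝔖.gal),
      ¬ 𝔖.TelecoreIncompatibleStmt θ ∧ ¬ 𝔖.Cor_3_7_iv θ ∧ ¬ 𝔖.LogKernelObstruction := by
  obtain ⟨𝔖, θ, K, hΔ, hT, hL, hobs⟩ := exists_thin_allPinned.{u}
  exact ⟨𝔖, θ, fun h => h ⟨K, hΔ, hT, hL⟩, fun h => h.2 ⟨K, hΔ, hT, hL⟩, hobs⟩

/-- **FACT-LIST F-0333, universal closure REFUTED**: it is false that `TelecoreIncompatibleStmt θ`
holds for every bi-anabelian setting and every lift datum (thin setting).  Print asserts it for the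
MLF data of Def 3.1 only, where Lemma 3.4 supplies the obstruction; instance forms:
`telecoreIncompatibleStmt_of_obstruction`, `TFModel.model_cor_3_7_iv`.
[cite: MochizukiAbsTopIII2015, Cor 3.7 (iv) p.88] -/
theorem not_forall_telecoreIncompatibleStmt :
    ¬ ∀ {X E N : Type u} [Category.{u} X] [Category.{u} E] [Category.{u} N]
        (𝔖 : BiAnabelianSetting X E N) (θ : FiberSquare.BiAnabelianLift 𝔖.gal),
        𝔖.TelecoreIncompatibleStmt θ := by
  intro h
  obtain ⟨𝔖, θ, hn, -, -⟩ := exists_not_telecoreIncompatibleStmt.{u}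
  exact hn (h 𝔖 θ)

/-- **FACT-LIST F-0326, universal closure REFUTED**: it is false that `Cor_3_7_iv θ` (both
incompatibilities of Cor 3.7 (iv)) holds for every bi-anabelian setting and every lift datum (thin
setting).  Instance forms in the tree: `cor_3_7_iv_of_obstruction` (every setting with the Lemma-3.4
obstruction), `TFModel.model_cor_3_7_iv` / `TFModel.model_slim_cor_3_7` / `TFModel.model_of_cor_3_7`
(the model of MLF-Galois pairs on `ℚ̄_p` and its sub-models), `cor_3_7_hypotheses_satisfiable`.
[cite: MochizukiAbsTopIII2015, Cor 3.7 (iv) p.88] -/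
theorem not_forall_cor_3_7_iv :
    ¬ ∀ {X E N : Type u} [Category.{u} X] [Category.{u} E] [Category.{u} N]
        (𝔖 : BiAnabelianSetting X E N) (θ : FiberSquare.BiAnabelianLift 𝔖.gal), 𝔖.Cor_3_7_iv θ := by
  intro h
  obtain ⟨𝔖, θ, -, hn, -⟩ := exists_not_telecoreIncompatibleStmt.{u}
  exact hn (h 𝔖 θ)

/-- **FACT-LIST F-0331, universal closure REFUTED**: `TelePinned K` does not hold for every family `K`
on `𝒟*` (the empty family at the thin setting — indeed at any setting, `exists_not_telePinned`).
[cite: MochizukiAbsTopIII2015, Cor 3.7 (iv) p.88] -/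
theorem not_forall_telePinned :
    ¬ ∀ {X E N : Type u} [Category.{u} X] [Category.{u} E] [Category.{u} N]
        (𝔖 : BiAnabelianSetting X E N) (K : 𝔖.starDiagram.HomotopyFamily), 𝔖.TelePinned K := by
  intro h
  obtain ⟨𝔖, -, -⟩ := exists_thin_allPinned.{u}
  obtain ⟨K, hK⟩ := 𝔖.exists_not_telePinned
  exact hK (h 𝔖 K)

/-- **FACT-LIST F-0330, universal closure REFUTED**: `StarLogPinned K` does not hold for every family
`K` on `𝒟*` (the empty family at the thin setting — indeed at any setting, `exists_not_starLogPinned`).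
[cite: MochizukiAbsTopIII2015, Cor 3.7 (iv) p.88] -/
theorem not_forall_starLogPinned :
    ¬ ∀ {X E N : Type u} [Category.{u} X] [Category.{u} E] [Category.{u} N]
        (𝔖 : BiAnabelianSetting X E N) (K : 𝔖.starDiagram.HomotopyFamily), 𝔖.StarLogPinned K := by
  intro h
  obtain ⟨𝔖, -, -⟩ := exists_thin_allPinned.{u}
  obtain ⟨K, hK⟩ := 𝔖.exists_not_starLogPinned
  exact hK (h 𝔖 K)

/-- Conversely all three pinning predicates are JOINTLY satisfiable at some setting (the thin one), so
none of `DeltaPinned`, `TelePinned`, `StarLogPinned` is vacuous and the content of Cor 3.7 (iv) lies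
in the setting (Lemma 3.4), not in the shape of the predicates. [cite: MochizukiAbsTopIII2015, Cor 3.7 (iv) p.88] -/
theorem exists_deltaPinned_telePinned_starLogPinned :
    ∃ (X E N : Type u) (_ : Category.{u} X) (_ : Category.{u} E) (_ : Category.{u} N)
      (𝔖 : BiAnabelianSetting X E N) (θ : FiberSquare.BiAnabelianLift 𝔖.gal)
      (K : 𝔖.starDiagram.HomotopyFamily), 𝔖.DeltaPinned θ K ∧ 𝔖.TelePinned K ∧ 𝔖.StarLogPinned K := by
  obtain ⟨𝔖, θ, K, hΔ, hT, hL, -⟩ := exists_thin_allPinned.{u}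
  exact ⟨_, _, _, inferInstance, inferInstance, inferInstance, 𝔖, θ, K, hΔ, hT, hL⟩

end AbsTopIII.BiAnabelianSetting

end Literature.AnabelianGeometry.AbsoluteAnabelian
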